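import Literature.MathematicalPhysics.QuantumFieldTheory.Balaban1983to89.B6CubeInDecayV1
import Literature.MathematicalPhysics.QuantumFieldTheory.Balaban1983to89.B6Ineq2133GDivLapTwoScaleV1
import HarnessLib

/-!
# `Balaban1983to89.B6CubeRightLegsV1` — T. Bałaban, *Propagators and renormalization transformations for lattice gauge theories. II*,
# Commun. Math. Phys. **96** (1984) 223–250 [Balaban1984PropagatorsII], (2.133)–(2.134) and (2.141) p. 247 with (2.91)–(2.94) p. 239:
# THE RIGHT LEGS OF THE CUBE MEMBERS FOR THE COLUMN WALK — `G_□·E_e` (`G_□∇_λ`, `G_□∇_λ*`) INPUT-LOCALISED, `G_□` OUTPUT-LOCALISED,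
# over the central reach `Q^T_□` with global decay (the twins of r03's `B6CubeInDecayV1` §4 `hEGin_cube` / `hGin_cube` in the other order)

statement-level skeleton of published theorems with citation tags; proofs where landed; nothing here is a claim about the Yang–Mills mass gap

PDF held: `paper:balaban1984-cmp96-propagators-rt-ii` (journal page = PDF page + 222): p. 247 [PDF 25] ((2.133): *"|(G_□J)(x)|, |(∇G_□J)(x)| ≤
O(1)[(L^jη)², L^jη]e^{−δ₂|y−y′|}|J|"*; (2.141): *"G = G₀(I − R)⁻¹ = Σ_{n=0}^∞ G₀Rⁿ = Σ_{ω=(□₀,…,□₂ₙ)} h_{□₀}G_{□₀}h_{□₀}·K_{□₁,□₂}G_{□₂}h_{□₂}· … ·K_{□₂ₙ₋₁,□₂ₙ}G_{□₂ₙ}h_{□₂ₙ}"*, *"and the series above is convergent in the norms appearing in the inequalities (2.136)–(2.140)"* — reading this walk on the COLUMNS of `G` (remainder transposed) is OURS (p38 g31's (2.136)₃ route), not displayed in print; (2.136)₃ *"|(G∇*J)(x)|"*), p. 239 [PDF 17] ((2.90)–(2.94)), p. 238 [PDF 16] (`□̃³ = T_□`);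
[Balaban1984PropagatorsI] (1.110) p. 35.  v1.1 (DOCFIX, family D-g75-1 of ref-4 gen 75): the v1.0 header paraphrased (2.141) with cut-offs `ζ` and
attributed a phrase *"their conjugates"* to p. 247 — neither is print; (2.141) is now quoted verbatim and the column reading labelled ours.  Lean unchanged.

CITATION HEADER (lean-in-tree rule) — WHAT IS REPRODUCED.  Phase-2 file of the `lit-balaban` typed skeleton (HOME `run/shared/lean/pub/lit-balaban/`),
unit `lit-balaban-p22` (gen 23), referee ref-4, B6 fold owner r03; SKELETON rows **B6.Eq2.133** × **B6.Eq2.134** × B6.Eq2.141 × B6.Prop2.6 (cells only;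
decls of record untouched).  p38 g31's ask (seat INBOX 2026-08-23T17:24:01Z, items (2)(a)(b)) for its (2.136)₃ TRANSPOSED-WALK route `G∇* = G₀ᵀ∇* +
Rᵀ(G∇*)`: the mirrored line-1 term `h·G_□·(M_□h_□ − h_□M_□)` is written with the differences adjacent to `G_□` ON THE RIGHT, so the member inputs are
`G_□E_e` for all `2(d+1)` legs (input-localised over the reach), and the mirrored line-2/line-4 pieces feed `G_□` from anywhere (output-localised
form).  IMPORTS BY NAME, restating nothing: r03's `…B6CubeInDecayV1` (`outMajorant_conj_chart`, the band data `hdiv_cube`, `hlev_full`, `hband_cube`,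
`sc_inv_le_pref`, `transplant_off`, the identities `Gl_eq`, `conj_mul`, `smul_kernel_le`), r03's `…B6InDecayWindowV1` (`inDecay_window_V1`,
`outDecay_window_V1`, `in/outMajorant_smul_of_le_on`), r05's `…B6InMajorantTransplant` (`InMajorant`, `inMajorant_conj_chart`), p22's F-lineage
`…B6Prop25GDivDecayTwoScaleV1.blockBound_GDadj_scaling` (`G_□∇_λ*`) and `…B6Ineq2133GDivLapTwoScaleV1.ineq2133_GDla`, p38's
`…B6Ineq2133TwoScaleV1` (`ineq2133_G`, `hasMajorant_of_blockBound`, `tsGeo`), p38's `…B6Eq292MemberTorusV1.EC`, r03's `…B6CubeWindowV1` (`Gl`, `tC`,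
`Placed`, `SQ`), `…B6BlockDecayHprimeCovV1.torusDist_blk_unshift_le_one`, `…B10StarCount.blockOf_shift`.

## WHAT THIS FILE CERTIFIES (kernel-checked, 0 sorry, standard axioms; theorems only — no `def`, no `def … : Prop`, no new named fact)

* §1 **`Gl_mul_EC_eq`** — `G_□·E_e = τ_{−v}(s(□)⁻¹•ε(G_□∘∇_e)ρ)τ_v` (r03's `EC_mul_Gl_eq` in the other order: `transplant_mul_of_bij` through the bijective
  window);
* §2 THE MEMBER RIGHT LEGS: `iterBlockOf_shift_or` (the block of `x + e_μ` is the block of `x` or its `μ`-neighbour, every scale — iterate of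
  `blockOf_shift`), `Dl_single_eq` (`∇_λe_{b′} = −∇_λ*e_{b′−e_λ}`), **`blockBound_GDl_scaling`** — NEW analytic bookkeeping: the block bound `(C, δ)` of
  `G_□∇_λ*` (p22 F14) gives `(C(1+e^δ), δ)` for `G_□∇_λ` (input shift by one fine bond: the shifted inputs of `B(y)` lie in `B(y) ∪ B(y − e_λ)`, a block at
  unit distance `≤ 1`), **`ineq2133_GDl`** (`HasMajorant (tsGeo i R M) y(·₋) (onFun (G_□ ∘ ∇_λ)) (A·e^{−δ|y−y′|_T})`), **`ineq2133_legs_right`** (both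
  right legs `G_□∇_λ`, `G_□∇_λ*` with ONE `(δ, A)`);
* §3 ON THE GLOBAL TORUS, for the genuine member of a placed cube (`L ≥ 5`, r03's quarter-point window): **`hGEin_cube`** — `∃ δ_G > 0, C_G ≥ 0` with
  `InMajorant (geomT D) (blkV1 hN D) (Gl □ * EC □ e) (Q^T_□) (C_G·(L^{j(y)}/c′)²·e^{−δ_G d_T(y,y′)})` for every `e : Fin (d+1) × Bool` (quantifier prefix of
  r03's `hEGin_cube` VERBATIM); **`hGout_cube`** — `OutMajorant (geomT D) (blkV1 hN D) (Gl □) (Q^T_□) (C_G·(L^{j(y)}/c′)²·e^{−δ_G d_T})` (prefix of r03's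
  `hGin_cube` verbatim; unfolded: `∀ y′ μ B, BlockSupp μ y′ B → ∀ x, blkV1 x ∈ Q^T_□ → |G_□μ x| ≤ C_G·pref(blkV1 x)·e^{−δ_G d_T(blkV1 x, y′)}·B`);
  **`hGEin_cube_sc`**, **`hGout_cube_sc`** — the same two in the RAW UNIFORM form, kernel `C_G·s(□)⁻¹·e^{−δ_G d_T}` with the cube's own unit
  `s(□)⁻¹ = (L^{j₀}/c′)²` (`B6CubeWindowV1.sc`) before `sc_inv_le_pref` (p38's request: the weight is then placed at the input block by the consumer).

## HONEST SCOPE / DIVERGENCES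

(1) Print states (2.133) for `G_□J`, `∇G_□J`, lists the right entry `|(G∇*J)(x)|` in (2.136) and asserts the convergence of the walk (2.141) in the
norms of (2.136)–(2.140); the column reading of (2.141) (p38 g31's route) and the explicit `G_□∇_λ` block bound by an input shift are OUR bookkeeping
(constant `C(1+e^δ)`, same rate).  (2) As in `B6CubeInDecayV1`: `L ≥ 5` (`ℓ ≥ 4`),
`M_h = L^a`, `R ≥ 2L²`, placed cube, rate `δ₂/(9(d+1))`, constants ours; the prefactor of `G_□E_e` is `(L^{j(y)}/c′)²` (the unit sits in p38's
coefficients).  (3) Integer torus, lattice units, p21's reading R2 of (2.46); nothing on (2.136)₃ itself, on d = 4 or the continuum; NOT summit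
progress.  (4) Theorems only; standard axioms.  Unit `lit-balaban-p22` (gen 23), 2026-08-23.
-/

noncomputable section

open scoped BigOperators
open Finset

namespace Literature.MathematicalPhysics.QuantumFieldTheory.Balaban1983to89.B6CubeRightLegsV1

open LatticeFieldCalculus
open B6RandomWalk (HasMajorant BlockSupp hasMajorant_mono)
open B6Prop26Gluing (mulOp LocalMajorant)
open B6InMajorantTransplant (InMajorant inMajorant_mono inMajorant_congr_set inMajorant_conj_chart)
open B6InDecayWindowV1 (OutMajorant outMajorant_mono outMajorant_congr_set inMajorant_smul_of_le_on outMajorant_smul_of_le_on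
  transplant_apply_of_not_mem inDecay_window_V1 outDecay_window_V1)
open B4Reflection242 (boxDom)
open B6MultiLevelBoxOperator (N0)
open B6MultiLevelTorusOperator (TDomains)
open B6Eq238MultiLevelTorus (svec)
open B6Cover236MultiLevelBlocks (cubes)
open B6Geom246MultiLevelBox (bset)
open B6Partition118KLevelTorusCentral (one_le_of_four_le)
open B6GlobalChartV1 (PV toBox blkV1 domT GlV1)
open B6AgreeLapV1Chart (cB eB posV mem_cB_W transplant_eB_eq GlV1_eq onFun_comp)
open B6Prop25TwoScaleCensus (TSIdx)
open B6Prop26KLevelSkeletonV1 (ST pref pref_nonneg)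
open B6Geom246MultiLevelTorus (geomT blkMap)
open B6SectAOperatorsV1 (BondIdx)
open B6Ineq2133TwoScaleV1 (onFun onFun_apply tsGeo hasMajorant_of_blockBound ineq2133_G)
open B6Ineq2133GDivLapTwoScaleV1 (ineq2133_GDla)
open B6Prop25GDivDecayTwoScaleV1 (blockBound_GDadj_scaling)
open B6Prop26ReachTransplant (transplant transplant_mul_of_bij)
open B6TranslateTorusV1 (vch TB kernel_blkMap)
open B6Eq292MemberTorusV1 (EC)
open B6CubeWindowV1 (x0 j0 tC sc hx0 hfit Placed wC Gl SQ mem_SQ mem_blkMap_image_SQ)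
open B6CubeInDecayV1 (outMajorant_conj_chart hdiv_cube hlev_full hband_cube sc_inv_le_pref transplant_off conj_mul Gl_eq sc_nonneg smul_kernel_le)
open B5Eq118OneStroke (iterBlockOf iterBlockOf_succ)

variable {d ℓ : ℕ} {hd : 1 ≤ d + 1} {hL : Odd (ℓ + 1) ∧ 1 < ℓ + 1} {a₀ a₁ : ℝ} {m K : ℕ} {Mh k R : ℕ} {P' : Fin (d + 1) → ℕ}

/-! ## §1  `G_□·E_e` of the cube as a conjugated scaled transplant (r03's `EC_mul_Gl_eq` in the other order) -/

section Identity

variable (hN : ∀ μ, N0 ℓ Mh k P' μ = (PV d ℓ m K hd hL).sitesPerDir 0) {D : TDomains d ℓ Mh k P' R} (hk : k ≤ m + K)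
  (hMh1 : 1 ≤ Mh) (hP4 : ∀ μ, 4 ≤ P' μ) {a : ℕ} (hMha : Mh = (ℓ + 1) ^ a) (c : ↥(cubes D.toDomains)) (ha : a₀ ≤ a₁)

/-- **`G_□·E_e` OF THE CUBE = `τ_{−v}(s(□)⁻¹•ε(G_□∘∇_e)ρ)τ_v`** (`∇_e = ∇_λ` or `∇_λ*`): the product of the two transplants through the BIJECTIVE window is
the transplant of the product — r03's `B6CubeInDecayV1.EC_mul_Gl_eq` in the other order (the right legs of OUR column reading of the walk (2.141)).
[cite: Balaban1984PropagatorsII, (2.92) p.239 (line 1), (2.133), (2.141) p.247, p.238 (T_□ = □̃³), dictionary (charts); bookkeeping ours] -/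
theorem Gl_mul_EC_eq (hpl : Placed ℓ k P' c.1) (w : BondIdx (domT hN D hk) → ℝ) (cf : ℝ) (e : Fin (d + 1) × Bool) :
    Gl hN hk hMh1 hP4 hMha c ha hpl w cf * EC hN hk hMh1 hP4 hMha c ha hpl w cf e = TB (-vch Mh k (svec ℓ k c.1.1 c.1.2)) *
      ((sc hMh1 hP4 c cf)⁻¹ • transplant (cB (tC hN hk hMh1 hP4 c ha a (wC hN hk c w) cf) (x0 ℓ Mh k c.1) (hx0 hpl) (hfit hN hMh1 hP4 hMha c ha hpl)).W
        (eB (tC hN hk hMh1 hP4 c ha a (wC hN hk c w) cf) (x0 ℓ Mh k c.1))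
        (onFun ((tC hN hk hMh1 hP4 c ha a (wC hN hk c w) cf).D.G ∘ₗ
          (if e.2 then (tC hN hk hMh1 hP4 c ha a (wC hN hk c w) cf).Dl e.1 else (tC hN hk hMh1 hP4 c ha a (wC hN hk c w) cf).Dla e.1)))) *
      TB (vch Mh k (svec ℓ k c.1.1 c.1.2)) := by
  rw [EC, Gl_eq, conj_mul, smul_mul_assoc, onFun_comp, ← Module.End.mul_eq_comp,
    transplant_mul_of_bij (W := (cB (tC hN hk hMh1 hP4 c ha a (wC hN hk c w) cf) (x0 ℓ Mh k c.1) (hx0 hpl) (hfit hN hMh1 hP4 hMha c ha hpl)).W)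
      (e := eB (tC hN hk hMh1 hP4 c ha a (wC hN hk c w) cf) (x0 ℓ Mh k c.1))
      (cB (tC hN hk hMh1 hP4 c ha a (wC hN hk c w) cf) (x0 ℓ Mh k c.1) (hx0 hpl) (hfit hN hMh1 hP4 hMha c ha hpl)).inj
      (cB (tC hN hk hMh1 hP4 c ha a (wC hN hk c w) cf) (x0 ℓ Mh k c.1) (hx0 hpl) (hfit hN hMh1 hP4 hMha c ha hpl)).surj]

end Identity


/-! ## §2  The member RIGHT legs `G_□∇_λ`, `G_□∇_λ*` with ONE pair of constants (the `∇_λ` leg is NEW: input shift of p22's `G_□∇_λ*` block bound) -/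

section RightLeg

open LatticeFieldCalculus B5Eq117TorusCarriers B6SectAOperatorsV1 B6SectCOperators B6SectCTwoScaleV1 B6SectCTwoScaleV1Lattice
open BalabanImbrieJaffe1984to88.BIJ85AxialPropagator411 (BondSpace)
open B4TorusKernel.MultiPeriod (torusSupNorm)
open B6LowerBound2153Torus (rep)
open B6BlockDecayCalculus (torusDist_isPseudoDist)
open B6BlockDecayHprimeCovV1 (torusDist_blk_unshift_le_one)
open B10StarCount (shift_unshift unshift_shift blockOf_shift)

variable {d L : ℕ} {hd : 1 ≤ d + 1} {hL : Odd L ∧ 1 < L} {a₀ a₁ : ℝ}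

/-- **THE BLOCK OF `x + e_μ` IS THE BLOCK OF `x` OR ITS `μ`-NEIGHBOUR** at every scale `n ≤ m + K` (iterate of `B10StarCount.blockOf_shift`).
[cite: Balaban1984PropagatorsI, (1.6) p.18 («divide the lattice into blocks»), (1.18) p.20; bookkeeping ours] -/
theorem iterBlockOf_shift_or {P : Params} : ∀ (n : ℕ), n ≤ P.m + P.K → ∀ (x : Site P 0) (μ : Fin P.d),
    iterBlockOf n (x.shift μ) = iterBlockOf n x ∨ iterBlockOf n (x.shift μ) = (iterBlockOf n x).shift μ
  | 0, _, _, _ => Or.inr rfl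
  | n + 1, hn, x, μ => by
    rcases iterBlockOf_shift_or n (by omega) x μ with h | h
    · left; rw [iterBlockOf_succ, iterBlockOf_succ, h]
    · rw [iterBlockOf_succ, iterBlockOf_succ, h, blockOf_shift (by omega) (iterBlockOf n x) μ]
      split_ifs
      · right; rfl
      · left; rfl

section Singles

-- `e_{b′}` is written below with the CLASSICAL `DecidableEq (PBond _ 0)` spelled out — the instance with which p22's F-lineage block bounds
-- (`blockBound_GDadj_scaling`) and p38's `hasMajorant_of_blockBound` were elaborated (this file also sees r05's structural instance, which must
-- not be picked in these statements).

open Classical in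
/-- **`∇_λ e_{b′} = −∇_λ* e_{b′ − e_λ}`** on the fine bond fields of a member (`∇_λ = L^j(S_λ − 1)`, `∇_λ* = L^j(S_λ⁻¹ − 1)`, `S_λ e_{b′} = e_{b′ − e_λ}`).
[cite: Balaban1984PropagatorsI, (1.4) p.18, (1.89) p.33; bookkeeping ours] -/
theorem Dl_single_eq (i : TSIdx d L hd hL a₀ a₁) (lam : Fin i.P.d) (b' : PBond i.P 0) :
    i.Dl lam ((@EuclideanSpace.single (PBond i.P 0) ℝ _ (fun a b => Classical.propDecidable (a = b)) b' (1 : ℝ))) = -i.Dla lam ((@EuclideanSpace.single (PBond i.P 0) ℝ _ (fun a b => Classical.propDecidable (a = b)) ⟨b'.src.unshift lam, b'.dir⟩ (1 : ℝ))) := by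
  refine PiLp.ext fun b => ?_
  rw [PiLp.neg_apply, TSIdx.Dl_apply, TSIdx.Dla_apply, PiLp.single_apply, PiLp.single_apply, PiLp.single_apply, PiLp.single_apply]
  have key1 : ((⟨b.src.unshift lam, b.dir⟩ : PBond i.P 0) = ⟨b'.src.unshift lam, b'.dir⟩) ↔ b = b' := by
    constructor
    · intro h
      obtain ⟨hs, hdir⟩ := PBond.mk.inj h
      have hs' : (b.src.unshift lam).shift lam = (b'.src.unshift lam).shift lam := by rw [hs]
      rw [shift_unshift, shift_unshift] at hs'
      cases b; cases b'
      simp only at hs' hdir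
      rw [hs', hdir]
    · rintro rfl; rfl
  have key2 : (b = ⟨b'.src.unshift lam, b'.dir⟩) ↔ (⟨b.src.shift lam, b.dir⟩ : PBond i.P 0) = b' := by
    constructor
    · rintro rfl
      show (⟨(b'.src.unshift lam).shift lam, b'.dir⟩ : PBond i.P 0) = b'
      rw [shift_unshift]
    · rintro rfl
      show b = ⟨(b.src.shift lam).unshift lam, b.dir⟩
      rw [unshift_shift]
  simp only [key1, key2]
  split_ifs <;> ring

open Classical in
/-- the entries of `G_□∇_λ` are entries of `G_□∇_λ*` one input bond over: `|(G∇_λ)(e_{b′})(b)| = |(G∇_λ*)(e_{b′−e_λ})(b)|`.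
[cite: Balaban1984PropagatorsI, (1.4) p.18, (1.110) p.35; bookkeeping ours] -/
theorem abs_GDl_single_eq (i : TSIdx d L hd hL a₀ a₁) (lam : Fin i.P.d) (b' b : PBond i.P 0) :
    |(i.D.G ∘ₗ i.Dl lam) ((@EuclideanSpace.single (PBond i.P 0) ℝ _ (fun a b => Classical.propDecidable (a = b)) b' (1 : ℝ))) b| =
      |(i.D.G ∘ₗ i.Dla lam) ((@EuclideanSpace.single (PBond i.P 0) ℝ _ (fun a b => Classical.propDecidable (a = b)) ⟨b'.src.unshift lam, b'.dir⟩ (1 : ℝ))) b| := by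
  rw [LinearMap.comp_apply, LinearMap.comp_apply, Dl_single_eq, map_neg, PiLp.neg_apply, abs_neg]

open Classical in
/-- **`G_□∇_λ` HAS AN EXPONENTIALLY DECAYING BLOCK KERNEL, UNIFORMLY** — the INPUT-SHIFT twin of p22 F14's `blockBound_GDadj_scaling` (`G_□∇_λ*`):
`(G∇_λ)(e_{b′})(b) = −(G∇_λ*)(e_{b′−e_λ})(b)`, and the bonds `b′ − e_λ`, `b′₋ ∈ B(y)`, have their source in `B(y)` or in `B(y − e_λ)`
(`iterBlockOf_shift_or`), a block at unit distance `≤ 1` (`torusDist_blk_unshift_le_one`): the block bound `(C, δ)` of `G_□∇_λ*` gives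
`(C(1 + e^δ), δ)` for `G_□∇_λ`. [cite: Balaban1984PropagatorsII, (2.133) p.247, (2.136) p.247 («|(G∇*J)(x)|»), (2.141) p.247 (the walk; its column
reading ours); Balaban1984PropagatorsI, (1.110) p.35; bookkeeping ours] -/
theorem blockBound_GDl_scaling (d L : ℕ) (hd : 1 ≤ d + 1) (hL : Odd L ∧ 1 < L) {a₀ a₁ : ℝ} (ha₀ : 0 < a₀) (ha₁ : a₀ ≤ a₁) :
    ∃ δ : ℝ, 0 < δ ∧ ∃ C : ℝ, 0 ≤ C ∧ ∀ (i : TSIdx d L hd hL a₀ a₁) (lam : Fin i.P.d) (b : PBond i.P 0) (y : Site i.P i.j),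
      ∑ b' ∈ univ.filter (fun b' : PBond i.P 0 => iterBlockOf i.j b'.src = y), |(i.D.G ∘ₗ i.Dl lam) ((@EuclideanSpace.single (PBond i.P 0) ℝ _ (fun a b => Classical.propDecidable (a = b)) b' (1 : ℝ))) b| ≤
        C * Real.exp (-(δ * i.tdist (iterBlockOf i.j b.src) y)) := by
  obtain ⟨δ, hδ, C, hC, h⟩ := blockBound_GDadj_scaling d L hd hL ha₀ ha₁
  have hGDla : ∀ (i : TSIdx d L hd hL a₀ a₁) (lam : Fin i.P.d) (b : PBond i.P 0) (y : Site i.P i.j),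
      ∑ b' ∈ univ.filter (fun b' : PBond i.P 0 => iterBlockOf i.j b'.src = y), |(i.D.G ∘ₗ i.Dla lam) ((@EuclideanSpace.single (PBond i.P 0) ℝ _ (fun a b => Classical.propDecidable (a = b)) b' (1 : ℝ))) b| ≤
        C * Real.exp (-(δ * i.tdist (iterBlockOf i.j b.src) y)) :=
    fun i lam b y => h i.m i.K i.j i.hc i.hj i.Λ' i.w i.hw0 i.hw1 lam b y
  refine ⟨δ, hδ, C * (1 + Real.exp δ), by positivity, fun i lam b y => ?_⟩
  have hj' : i.j ≤ i.P.m + i.P.K := Nat.le_of_succ_le i.hj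
  set f : PBond i.P 0 → ℝ := fun b'' => |(i.D.G ∘ₗ i.Dla lam) ((@EuclideanSpace.single (PBond i.P 0) ℝ _ (fun a b => Classical.propDecidable (a = b)) b'' (1 : ℝ))) b| with hf
  have hf0 : ∀ b'', 0 ≤ f b'' := fun b'' => abs_nonneg _
  set u : PBond i.P 0 → PBond i.P 0 := fun b' => ⟨b'.src.unshift lam, b'.dir⟩ with hu
  have hu_inj : ∀ b₁ ∈ univ.filter (fun b' : PBond i.P 0 => iterBlockOf i.j b'.src = y),
      ∀ b₂ ∈ univ.filter (fun b' : PBond i.P 0 => iterBlockOf i.j b'.src = y), u b₁ = u b₂ → b₁ = b₂ := by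
    intro b₁ _ b₂ _ h12
    have h12' : (⟨b₁.src.unshift lam, b₁.dir⟩ : PBond i.P 0) = ⟨b₂.src.unshift lam, b₂.dir⟩ := h12
    obtain ⟨hs, hdir⟩ := PBond.mk.inj h12'
    have hs' : (b₁.src.unshift lam).shift lam = (b₂.src.unshift lam).shift lam := by rw [hs]
    rw [shift_unshift, shift_unshift] at hs'
    cases b₁; cases b₂
    simp only at hs' hdir
    rw [hs', hdir]
  -- reindex the sum by `u`
  have e1 : ∑ b' ∈ univ.filter (fun b' : PBond i.P 0 => iterBlockOf i.j b'.src = y), |(i.D.G ∘ₗ i.Dl lam) ((@EuclideanSpace.single (PBond i.P 0) ℝ _ (fun a b => Classical.propDecidable (a = b)) b' (1 : ℝ))) b| =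
      ∑ b'' ∈ (univ.filter (fun b' : PBond i.P 0 => iterBlockOf i.j b'.src = y)).image u, f b'' := by
    rw [Finset.sum_image hu_inj]
    exact Finset.sum_congr rfl fun b' _ => abs_GDl_single_eq i lam b' b
  rw [e1]
  set I := (univ.filter (fun b' : PBond i.P 0 => iterBlockOf i.j b'.src = y)).image u with hI
  -- the members of `I`: their shifted source has block `y`
  have hmemI : ∀ b'' ∈ I, iterBlockOf i.j (b''.src.shift lam) = y := by
    intro b'' hb''
    rw [hI, Finset.mem_image] at hb''
    obtain ⟨b', hb', rfl⟩ := hb''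
    rw [Finset.mem_filter] at hb'
    show iterBlockOf i.j ((b'.src.unshift lam).shift lam) = y
    rw [shift_unshift]; exact hb'.2
  -- split `I` by the block of the source
  rw [← Finset.sum_filter_add_sum_filter_not I (fun b'' : PBond i.P 0 => iterBlockOf i.j b''.src = y) f]
  have hA : ∑ b'' ∈ I.filter (fun b'' : PBond i.P 0 => iterBlockOf i.j b''.src = y), f b'' ≤
      C * Real.exp (-(δ * i.tdist (iterBlockOf i.j b.src) y)) := by
    refine le_trans (Finset.sum_le_sum_of_subset_of_nonneg ?_ fun b'' _ _ => hf0 b'') (hGDla i lam b y)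
    intro b'' hb''
    rw [Finset.mem_filter] at hb'' ⊢
    exact ⟨Finset.mem_univ _, hb''.2⟩
  have hB : ∑ b'' ∈ I.filter (fun b'' : PBond i.P 0 => ¬ iterBlockOf i.j b''.src = y), f b'' ≤
      C * Real.exp δ * Real.exp (-(δ * i.tdist (iterBlockOf i.j b.src) y)) := by
    rcases (I.filter (fun b'' : PBond i.P 0 => ¬ iterBlockOf i.j b''.src = y)).eq_empty_or_nonempty with h0 | ⟨b₀, hb₀⟩
    · rw [h0, Finset.sum_empty]; positivity
    · -- the off-block members all sit in the block `y − e_λ`, at unit distance `≤ 1` from `y`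
      have hoff : ∀ b'' ∈ I.filter (fun b'' : PBond i.P 0 => ¬ iterBlockOf i.j b''.src = y),
          iterBlockOf i.j b''.src = y.unshift lam ∧
            torusSupNorm (Mk i.P i.j) (rep (Mk i.P i.j) (iterBlockOf i.j b''.src) - rep (Mk i.P i.j) y) ≤ 1 := by
        intro b'' hb''
        rw [Finset.mem_filter] at hb''
        have hy := hmemI b'' hb''.1
        rcases iterBlockOf_shift_or i.j hj' b''.src lam with h1 | h1
        · exact absurd (h1.symm.trans hy) hb''.2
        · rw [hy] at h1
          have hdist := torusDist_blk_unshift_le_one hj' (b''.src.shift lam) lam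
          rw [unshift_shift, hy] at hdist
          refine ⟨?_, hdist⟩
          rw [h1, unshift_shift]
      obtain ⟨hy₀, hd₀⟩ := hoff b₀ hb₀
      have hsub : I.filter (fun b'' : PBond i.P 0 => ¬ iterBlockOf i.j b''.src = y) ⊆
          univ.filter (fun b' : PBond i.P 0 => iterBlockOf i.j b'.src = y.unshift lam) := by
        intro b'' hb''
        rw [Finset.mem_filter]
        exact ⟨Finset.mem_univ _, (hoff b'' hb'').1⟩
      refine le_trans (Finset.sum_le_sum_of_subset_of_nonneg hsub fun b'' _ _ => hf0 b'') ((hGDla i lam b (y.unshift lam)).trans ?_)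
      rw [mul_assoc, ← Real.exp_add]
      refine mul_le_mul_of_nonneg_left (Real.exp_le_exp.2 ?_) hC
      -- triangle inequality: `|y(b) − y|_T ≤ |y(b) − (y − e_λ)|_T + 1`
      have htri := (torusDist_isPseudoDist (Mk i.P i.j)).triangle (iterBlockOf i.j b.src) (y.unshift lam) y
      rw [← hy₀] at htri ⊢
      unfold TSIdx.tdist
      have hm := mul_le_mul_of_nonneg_left (htri.trans (add_le_add le_rfl hd₀)) hδ.le
      linarith
  calc ∑ b'' ∈ I.filter (fun b'' : PBond i.P 0 => iterBlockOf i.j b''.src = y), f b'' +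
        ∑ b'' ∈ I.filter (fun b'' : PBond i.P 0 => ¬ iterBlockOf i.j b''.src = y), f b''
      ≤ C * Real.exp (-(δ * i.tdist (iterBlockOf i.j b.src) y)) + C * Real.exp δ * Real.exp (-(δ * i.tdist (iterBlockOf i.j b.src) y)) :=
        add_le_add hA hB
    _ = C * (1 + Real.exp δ) * Real.exp (-(δ * i.tdist (iterBlockOf i.j b.src) y)) := by ring

end Singles

open Classical in
/-- **`G_□∇_λ` HAS THE (2.133) MAJORANT ON THE MEMBER GEOMETRY** (the right `∇`-leg): ONE `(δ, A)` on `d, L, a₀, a₁` for all members, `R, M` and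
directions. [cite: Balaban1984PropagatorsII, (2.133), (2.141) p.247; Balaban1984PropagatorsI, (1.110) p.35] -/
theorem ineq2133_GDl (d L : ℕ) (hd : 1 ≤ d + 1) (hL : Odd L ∧ 1 < L) {a₀ a₁ : ℝ} (ha₀ : 0 < a₀) (ha₁ : a₀ ≤ a₁) :
    ∃ δ : ℝ, 0 < δ ∧ ∃ A : ℝ, 0 ≤ A ∧ ∀ (i : TSIdx d L hd hL a₀ a₁) (R M : ℝ) (lam : Fin i.P.d),
      HasMajorant (g := tsGeo i R M) (fun b : PBond i.P 0 => iterBlockOf i.j b.src) (onFun (i.D.G ∘ₗ i.Dl lam))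
        (fun y y' => A * Real.exp (-(δ * i.tdist y y'))) := by
  obtain ⟨δ, hδ, C, hC, h⟩ := blockBound_GDl_scaling d L hd hL ha₀ ha₁
  exact ⟨δ, hδ, C, hC, fun i R M lam => hasMajorant_of_blockBound i R M (i.D.G ∘ₗ i.Dl lam) fun b y => h i lam b y⟩

/-- monotonicity of the exponential majorant in the constant and the rate. [folklore] -/
private theorem expMajorant_mono {A A' δ δ' t : ℝ} (hA : A ≤ A') (hA' : 0 ≤ A') (hδ : δ' ≤ δ) (ht : 0 ≤ t) :
    A * Real.exp (-(δ * t)) ≤ A' * Real.exp (-(δ' * t)) :=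
  (mul_le_mul_of_nonneg_right hA (Real.exp_nonneg _)).trans
    (mul_le_mul_of_nonneg_left (Real.exp_le_exp.mpr (neg_le_neg (mul_le_mul_of_nonneg_right hδ ht))) hA')

/-- **THE TWO RIGHT LEGS `G_□∇_λ`, `G_□∇_λ*` OF THE MEMBER WITH ONE PAIR OF CONSTANTS** (`ineq2133_GDl`, p22's `ineq2133_GDla`).
[cite: Balaban1984PropagatorsII, (2.133), (2.141) p.247, Prop. 2.5 p.246] -/
theorem ineq2133_legs_right (d L : ℕ) (hd : 1 ≤ d + 1) (hL : Odd L ∧ 1 < L) {a₀ a₁ : ℝ} (ha₀ : 0 < a₀) (ha₁ : a₀ ≤ a₁) :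
    ∃ δ : ℝ, 0 < δ ∧ ∃ A : ℝ, 0 ≤ A ∧ ∀ (t : TSIdx d L hd hL a₀ a₁) (e : Fin t.P.d × Bool),
      HasMajorant (g := tsGeo t 0 0) (fun b : PBond t.P 0 => iterBlockOf t.j b.src) (onFun (t.D.G ∘ₗ (if e.2 then t.Dl e.1 else t.Dla e.1)))
        (fun y y' => A * Real.exp (-(δ * t.tdist y y'))) := by
  obtain ⟨δ₁, hδ₁, A₁, hA₁, h₁⟩ := ineq2133_GDl d L hd hL ha₀ ha₁
  obtain ⟨δ₂, hδ₂, A₂, hA₂, h₂⟩ := ineq2133_GDla d L hd hL ha₀ ha₁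
  refine ⟨min δ₁ δ₂, lt_min hδ₁ hδ₂, max A₁ A₂, le_max_of_le_left hA₁, fun t e => ?_⟩
  obtain ⟨lam, bb⟩ := e
  cases bb
  · exact hasMajorant_mono _ (h₂ t 0 0 lam)
      (fun y y' => expMajorant_mono (le_max_right _ _) (le_max_of_le_left hA₁) (min_le_right _ _) (t.tdist_nonneg y y'))
  · exact hasMajorant_mono _ (h₁ t 0 0 lam)
      (fun y y' => expMajorant_mono (le_max_left _ _) (le_max_of_le_left hA₁) (min_le_left _ _) (t.tdist_nonneg y y'))

end RightLeg

/-! ## §3  THE CUBE'S RIGHT LEGS ON THE GLOBAL TORUS: `hGEin_cube` (`G_□E_e`, input-localised), `hGout_cube` (`G_□`, output-localised) -/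

section Cube

/-- **`hGE` FOR THE CUBE (INPUT-LOCALISED, GLOBAL DECAY): THE RIGHT LEGS `G_□·E_e`** (`e = (λ, ±)`: `G_□∇_λ`, `G_□∇_λ*`, p38's `EC`) have
`InMajorant (geomT D) (blkV1 hN D) (G_□·E_e) (Q^T_□) (C·(L^{j(y)}/c′)²·e^{−δ_G d_T})`, one `(δ_G, C)` for all cubes and legs (`L ≥ 5`) — the mirror of
r03's `B6CubeInDecayV1.hEGin_cube` (`E_e·G_□`), same band bridge `inDecay_window_V1`, member input `ineq2133_legs_right`, identity `Gl_mul_EC_eq`; the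
quantifier prefix is r03's VERBATIM. [cite: Balaban1984PropagatorsII, (2.133) p.247, (2.141) p.247 («h_{□₀}G_{□₀}h_{□₀}·K_{□₁,□₂}G_{□₂}h_{□₂}…», read on the
columns — ours), (2.92) p.239 (line 1), (2.134) p.247] -/
theorem hGEin_cube (d ℓ : ℕ) (hd : 1 ≤ d + 1) (hL : Odd (ℓ + 1) ∧ 1 < ℓ + 1) {a₀ a₁ : ℝ} (ha₀ : 0 < a₀) (ha₁ : a₀ ≤ a₁) :
    ∃ δG : ℝ, 0 < δG ∧ ∃ CG : ℝ, 0 ≤ CG ∧ ∀ (m K : ℕ) {Mh k R : ℕ} {P' : Fin (d + 1) → ℕ}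
      (hN : ∀ μ, N0 ℓ Mh k P' μ = (PV d ℓ m K hd hL).sitesPerDir 0) (D : TDomains d ℓ Mh k P' R) (hk : k ≤ m + K)
      (hMh1 : 1 ≤ Mh) (hP4 : ∀ μ, 4 ≤ P' μ) {a : ℕ} (hMha : Mh = (ℓ + 1) ^ a) (_ : 2 ≤ Mh) (_ : 2 * (ℓ + 1) ^ 2 ≤ R) (_ : 4 ≤ ℓ)
      (c : ↥(cubes D.toDomains)) (hpl : Placed ℓ k P' c.1) (w : BondIdx (domT hN D hk) → ℝ) (cf : ℝ) (e : Fin (d + 1) × Bool),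
      InMajorant (g := geomT D) (blkV1 hN D) (Gl hN hk hMh1 hP4 hMha c ha₁ hpl w cf * EC hN hk hMh1 hP4 hMha c ha₁ hpl w cf e) (ST D hMh1 hP4 c)
        (fun y y' => CG * pref cf y * Real.exp (-(δG * (geomT D).dist y y'))) := by
  obtain ⟨δ, hδ, A, hA, hmem⟩ := ineq2133_legs_right d (ℓ + 1) hd hL ha₀ ha₁
  refine ⟨δ / (((d : ℝ) + 1) * ((9 : ℕ) : ℝ)), by positivity,
    (((ℓ + 1) ^ (d + 1) : ℕ) : ℝ) * (A * Real.exp (δ * (((d : ℝ) + 1) + ((d : ℝ) + 1)) / (((d : ℝ) + 1) * ((9 : ℕ) : ℝ)))), by positivity, ?_⟩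
  intro m K Mh k R P' hN D hk hMh1 hP4 a hMha hMh hR2 hℓ c hpl w cf e
  have hP : ∀ μ, 1 ≤ P' μ := one_le_of_four_le hP4
  have h1 := inDecay_window_V1 (t := tC hN hk hMh1 hP4 c ha₁ a (wC hN hk c w) cf) (x₀ := x0 ℓ Mh k c.1) (hx₀ := hx0 hpl)
    (hfit := hfit hN hMh1 hP4 hMha c ha₁ hpl) hN (D.chart (svec ℓ k c.1.1 c.1.2)) hA hδ.le (hmem _ e) hMh1 hP
    (hdiv_cube hN hk hMh1 hP4 c ha₁ (wC hN hk c w) cf) (hlev_full hN hk hMh1 hP4 hMha c ha₁ hR2 (wC hN hk c w) cf) (C := 9) (by norm_num)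
    (SQ hMh1 hP4 c) (fun b _ hbS => hband_cube hN hk hMh1 hP4 hMha c ha₁ hℓ hMh hR2 (wC hN hk c w) cf b hbS)
  have h2 := inMajorant_smul_of_le_on (blkV1 hN (D.chart (svec ℓ k c.1.1 c.1.2))) h1 _
    (transplant_off hN hk hMh1 hP4 hMha c ha₁ hpl (wC hN hk c w) cf _) (inv_nonneg.2 (sc_nonneg hMh1 hP4 c cf))
    (K' := fun y y' => (((ℓ + 1) ^ (d + 1) : ℕ) : ℝ) * (A * Real.exp (δ * (((d : ℝ) + 1) + ((d : ℝ) + 1)) / (((d : ℝ) + 1) * ((9 : ℕ) : ℝ)))) *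
      pref cf y * Real.exp (-(δ / (((d : ℝ) + 1) * ((9 : ℕ) : ℝ)) * (geomT (D.chart (svec ℓ k c.1.1 c.1.2))).dist y y')))
    (fun a b => by have := pref_nonneg cf a; positivity)
    (fun b hb y _ => smul_kernel_le (sc_inv_le_pref hN hk hMh1 hP4 hMha c ha₁ hR2 hpl (wC hN hk c w) cf hb) (by positivity) (by positivity)
      (Real.exp_nonneg _))
  have h3 := inMajorant_conj_chart hN D hMh1 hP (svec ℓ k c.1.1 c.1.2) h2
    (K' := fun y y' => (((ℓ + 1) ^ (d + 1) : ℕ) : ℝ) * (A * Real.exp (δ * (((d : ℝ) + 1) + ((d : ℝ) + 1)) / (((d : ℝ) + 1) * ((9 : ℕ) : ℝ)))) *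
      pref cf y * Real.exp (-(δ / (((d : ℝ) + 1) * ((9 : ℕ) : ℝ)) * (geomT D).dist y y')))
    (fun a b => le_of_eq (kernel_blkMap D hMh1 hP (svec ℓ k c.1.1 c.1.2) (fun n => ((((ℓ + 1 : ℕ) : ℝ)) ^ n / cf) ^ 2) _ _ a b))
  rw [Gl_mul_EC_eq]
  exact inMajorant_congr_set _ (mem_blkMap_image_SQ hMh1 hP4 c) h3

/-- **`hGE` FOR THE CUBE IN THE RAW UNIFORM FORM** (p38 g31's request 18:29:12Z): the same input-localised majorant of `G_□·E_e` with the
two-scale estimate's own constant prefactor `s(□)⁻¹ = (L^{j₀}/c′)²` (BEFORE r03's `sc_inv_le_pref`), so that a consumer may place the weight at the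
INPUT block. [cite: Balaban1984PropagatorsII, (2.133), (2.141) p.247, (2.94) p.239 («s(□)» rescaling)] -/
theorem hGEin_cube_sc (d ℓ : ℕ) (hd : 1 ≤ d + 1) (hL : Odd (ℓ + 1) ∧ 1 < ℓ + 1) {a₀ a₁ : ℝ} (ha₀ : 0 < a₀) (ha₁ : a₀ ≤ a₁) :
    ∃ δG : ℝ, 0 < δG ∧ ∃ CG : ℝ, 0 ≤ CG ∧ ∀ (m K : ℕ) {Mh k R : ℕ} {P' : Fin (d + 1) → ℕ}
      (hN : ∀ μ, N0 ℓ Mh k P' μ = (PV d ℓ m K hd hL).sitesPerDir 0) (D : TDomains d ℓ Mh k P' R) (hk : k ≤ m + K)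
      (hMh1 : 1 ≤ Mh) (hP4 : ∀ μ, 4 ≤ P' μ) {a : ℕ} (hMha : Mh = (ℓ + 1) ^ a) (_ : 2 ≤ Mh) (_ : 2 * (ℓ + 1) ^ 2 ≤ R) (_ : 4 ≤ ℓ)
      (c : ↥(cubes D.toDomains)) (hpl : Placed ℓ k P' c.1) (w : BondIdx (domT hN D hk) → ℝ) (cf : ℝ) (e : Fin (d + 1) × Bool),
      InMajorant (g := geomT D) (blkV1 hN D) (Gl hN hk hMh1 hP4 hMha c ha₁ hpl w cf * EC hN hk hMh1 hP4 hMha c ha₁ hpl w cf e) (ST D hMh1 hP4 c)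
        (fun y y' => CG * (sc hMh1 hP4 c cf)⁻¹ * Real.exp (-(δG * (geomT D).dist y y'))) := by
  obtain ⟨δ, hδ, A, hA, hmem⟩ := ineq2133_legs_right d (ℓ + 1) hd hL ha₀ ha₁
  refine ⟨δ / (((d : ℝ) + 1) * ((9 : ℕ) : ℝ)), by positivity,
    (((ℓ + 1) ^ (d + 1) : ℕ) : ℝ) * (A * Real.exp (δ * (((d : ℝ) + 1) + ((d : ℝ) + 1)) / (((d : ℝ) + 1) * ((9 : ℕ) : ℝ)))), by positivity, ?_⟩
  intro m K Mh k R P' hN D hk hMh1 hP4 a hMha hMh hR2 hℓ c hpl w cf e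
  have hP : ∀ μ, 1 ≤ P' μ := one_le_of_four_le hP4
  have h1 := inDecay_window_V1 (t := tC hN hk hMh1 hP4 c ha₁ a (wC hN hk c w) cf) (x₀ := x0 ℓ Mh k c.1) (hx₀ := hx0 hpl)
    (hfit := hfit hN hMh1 hP4 hMha c ha₁ hpl) hN (D.chart (svec ℓ k c.1.1 c.1.2)) hA hδ.le (hmem _ e) hMh1 hP
    (hdiv_cube hN hk hMh1 hP4 c ha₁ (wC hN hk c w) cf) (hlev_full hN hk hMh1 hP4 hMha c ha₁ hR2 (wC hN hk c w) cf) (C := 9) (by norm_num)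
    (SQ hMh1 hP4 c) (fun b _ hbS => hband_cube hN hk hMh1 hP4 hMha c ha₁ hℓ hMh hR2 (wC hN hk c w) cf b hbS)
  have h2 := inMajorant_smul_of_le_on (blkV1 hN (D.chart (svec ℓ k c.1.1 c.1.2))) h1 _
    (transplant_off hN hk hMh1 hP4 hMha c ha₁ hpl (wC hN hk c w) cf _) (inv_nonneg.2 (sc_nonneg hMh1 hP4 c cf))
    (K' := fun y y' => (((ℓ + 1) ^ (d + 1) : ℕ) : ℝ) * (A * Real.exp (δ * (((d : ℝ) + 1) + ((d : ℝ) + 1)) / (((d : ℝ) + 1) * ((9 : ℕ) : ℝ)))) *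
      (sc hMh1 hP4 c cf)⁻¹ * Real.exp (-(δ / (((d : ℝ) + 1) * ((9 : ℕ) : ℝ)) * (geomT (D.chart (svec ℓ k c.1.1 c.1.2))).dist y y')))
    (fun a b => by have := sc_nonneg hMh1 hP4 c cf; positivity)
    (fun b _ y _ => smul_kernel_le le_rfl (by positivity) (by positivity) (Real.exp_nonneg _))
  have h3 := inMajorant_conj_chart hN D hMh1 hP (svec ℓ k c.1.1 c.1.2) h2
    (K' := fun y y' => (((ℓ + 1) ^ (d + 1) : ℕ) : ℝ) * (A * Real.exp (δ * (((d : ℝ) + 1) + ((d : ℝ) + 1)) / (((d : ℝ) + 1) * ((9 : ℕ) : ℝ)))) *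
      (sc hMh1 hP4 c cf)⁻¹ * Real.exp (-(δ / (((d : ℝ) + 1) * ((9 : ℕ) : ℝ)) * (geomT D).dist y y')))
    (fun a b => le_of_eq (kernel_blkMap D hMh1 hP (svec ℓ k c.1.1 c.1.2) (fun _ => (sc hMh1 hP4 c cf)⁻¹) _ _ a b))
  rw [Gl_mul_EC_eq]
  exact inMajorant_congr_set _ (mem_blkMap_image_SQ hMh1 hP4 c) h3

/-- **`hGout` FOR THE CUBE: THE GENUINE `G_□` HAS AN OUTPUT-LOCALISED MAJORANT OVER `Q^T_□` WITH GLOBAL DECAY AND PRINT'S PREFACTOR** (`L ≥ 5`):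
`OutMajorant (geomT D) (blkV1 hN D) (G_□) (Q^T_□) (C_G·(L^{j(y)}/c′)²·e^{−δ_G d_T(y,y′)})` — outputs over the central reach, inputs ANYWHERE; the twin
of r03's `B6CubeInDecayV1.hGin_cube` through `outDecay_window_V1` (same constants `δ_G = δ₂/(9(d+1))`, `C_G = L^{d+1}·A·e^{2δ₂/9}`).  Unfolded:
`∀ y′ μ B, BlockSupp (blkV1 hN D) μ y′ B → ∀ x, blkV1 hN D x ∈ Q^T_□ → |G_□ μ x| ≤ C_G·pref c′ (blkV1 hN D x)·e^{−δ_G d_T(blkV1 hN D x, y′)}·B`.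
[cite: Balaban1984PropagatorsII, (2.133) p.247, (2.134) p.247, (2.141) p.247, (2.90)–(2.94) p.239] -/
theorem hGout_cube (d ℓ : ℕ) (hd : 1 ≤ d + 1) (hL : Odd (ℓ + 1) ∧ 1 < ℓ + 1) {a₀ a₁ : ℝ} (ha₀ : 0 < a₀) (ha₁ : a₀ ≤ a₁) :
    ∃ δG : ℝ, 0 < δG ∧ ∃ CG : ℝ, 0 ≤ CG ∧ ∀ (m K : ℕ) {Mh k R : ℕ} {P' : Fin (d + 1) → ℕ}
      (hN : ∀ μ, N0 ℓ Mh k P' μ = (PV d ℓ m K hd hL).sitesPerDir 0) (D : TDomains d ℓ Mh k P' R) (hk : k ≤ m + K)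
      (hMh1 : 1 ≤ Mh) (hP4 : ∀ μ, 4 ≤ P' μ) {a : ℕ} (hMha : Mh = (ℓ + 1) ^ a) (_ : 2 ≤ Mh) (_ : 2 * (ℓ + 1) ^ 2 ≤ R) (_ : 4 ≤ ℓ)
      (c : ↥(cubes D.toDomains)) (hpl : Placed ℓ k P' c.1) (w : BondIdx (domT hN D hk) → ℝ) (cf : ℝ),
      OutMajorant (g := geomT D) (blkV1 hN D) (Gl hN hk hMh1 hP4 hMha c ha₁ hpl w cf) (ST D hMh1 hP4 c)
        (fun y y' => CG * pref cf y * Real.exp (-(δG * (geomT D).dist y y'))) := by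
  obtain ⟨δ, hδ, A, hA, hmem⟩ := ineq2133_G d (ℓ + 1) hd hL ha₀ ha₁
  refine ⟨δ / (((d : ℝ) + 1) * ((9 : ℕ) : ℝ)), by positivity,
    (((ℓ + 1) ^ (d + 1) : ℕ) : ℝ) * (A * Real.exp (δ * (((d : ℝ) + 1) + ((d : ℝ) + 1)) / (((d : ℝ) + 1) * ((9 : ℕ) : ℝ)))), by positivity, ?_⟩
  intro m K Mh k R P' hN D hk hMh1 hP4 a hMha hMh hR2 hℓ c hpl w cf
  have hP : ∀ μ, 1 ≤ P' μ := one_le_of_four_le hP4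
  have h1 := outDecay_window_V1 (t := tC hN hk hMh1 hP4 c ha₁ a (wC hN hk c w) cf) (x₀ := x0 ℓ Mh k c.1) (hx₀ := hx0 hpl)
    (hfit := hfit hN hMh1 hP4 hMha c ha₁ hpl) hN (D.chart (svec ℓ k c.1.1 c.1.2)) hA hδ.le (hmem _ 0 0) hMh1 hP
    (hdiv_cube hN hk hMh1 hP4 c ha₁ (wC hN hk c w) cf) (hlev_full hN hk hMh1 hP4 hMha c ha₁ hR2 (wC hN hk c w) cf) (C := 9) (by norm_num)
    (SQ hMh1 hP4 c) (fun b _ hbS => hband_cube hN hk hMh1 hP4 hMha c ha₁ hℓ hMh hR2 (wC hN hk c w) cf b hbS)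
  have h2 := outMajorant_smul_of_le_on (blkV1 hN (D.chart (svec ℓ k c.1.1 c.1.2))) h1 _
    (transplant_off hN hk hMh1 hP4 hMha c ha₁ hpl (wC hN hk c w) cf _) (inv_nonneg.2 (sc_nonneg hMh1 hP4 c cf))
    (K' := fun y y' => (((ℓ + 1) ^ (d + 1) : ℕ) : ℝ) * (A * Real.exp (δ * (((d : ℝ) + 1) + ((d : ℝ) + 1)) / (((d : ℝ) + 1) * ((9 : ℕ) : ℝ)))) *
      pref cf y * Real.exp (-(δ / (((d : ℝ) + 1) * ((9 : ℕ) : ℝ)) * (geomT (D.chart (svec ℓ k c.1.1 c.1.2))).dist y y')))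
    (fun a b => by have := pref_nonneg cf a; positivity)
    (fun b hb _ y => smul_kernel_le (sc_inv_le_pref hN hk hMh1 hP4 hMha c ha₁ hR2 hpl (wC hN hk c w) cf hb) (by positivity) (by positivity)
      (Real.exp_nonneg _))
  have h3 := outMajorant_conj_chart hN D hMh1 hP (svec ℓ k c.1.1 c.1.2) h2
    (K' := fun y y' => (((ℓ + 1) ^ (d + 1) : ℕ) : ℝ) * (A * Real.exp (δ * (((d : ℝ) + 1) + ((d : ℝ) + 1)) / (((d : ℝ) + 1) * ((9 : ℕ) : ℝ)))) *
      pref cf y * Real.exp (-(δ / (((d : ℝ) + 1) * ((9 : ℕ) : ℝ)) * (geomT D).dist y y')))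
    (fun a b => le_of_eq (kernel_blkMap D hMh1 hP (svec ℓ k c.1.1 c.1.2) (fun n => ((((ℓ + 1 : ℕ) : ℝ)) ^ n / cf) ^ 2) _ _ a b))
  rw [Gl_eq]
  exact outMajorant_congr_set _ (mem_blkMap_image_SQ hMh1 hP4 c) h3

/-- **`hGout` FOR THE CUBE IN THE RAW UNIFORM FORM** (p38 g31's request 18:29:12Z): the output-localised majorant of `G_□` with the constant
prefactor `s(□)⁻¹ = (L^{j₀}/c′)²`. [cite: Balaban1984PropagatorsII, (2.133), (2.141) p.247, (2.94) p.239] -/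
theorem hGout_cube_sc (d ℓ : ℕ) (hd : 1 ≤ d + 1) (hL : Odd (ℓ + 1) ∧ 1 < ℓ + 1) {a₀ a₁ : ℝ} (ha₀ : 0 < a₀) (ha₁ : a₀ ≤ a₁) :
    ∃ δG : ℝ, 0 < δG ∧ ∃ CG : ℝ, 0 ≤ CG ∧ ∀ (m K : ℕ) {Mh k R : ℕ} {P' : Fin (d + 1) → ℕ}
      (hN : ∀ μ, N0 ℓ Mh k P' μ = (PV d ℓ m K hd hL).sitesPerDir 0) (D : TDomains d ℓ Mh k P' R) (hk : k ≤ m + K)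
      (hMh1 : 1 ≤ Mh) (hP4 : ∀ μ, 4 ≤ P' μ) {a : ℕ} (hMha : Mh = (ℓ + 1) ^ a) (_ : 2 ≤ Mh) (_ : 2 * (ℓ + 1) ^ 2 ≤ R) (_ : 4 ≤ ℓ)
      (c : ↥(cubes D.toDomains)) (hpl : Placed ℓ k P' c.1) (w : BondIdx (domT hN D hk) → ℝ) (cf : ℝ),
      OutMajorant (g := geomT D) (blkV1 hN D) (Gl hN hk hMh1 hP4 hMha c ha₁ hpl w cf) (ST D hMh1 hP4 c)
        (fun y y' => CG * (sc hMh1 hP4 c cf)⁻¹ * Real.exp (-(δG * (geomT D).dist y y'))) := by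
  obtain ⟨δ, hδ, A, hA, hmem⟩ := ineq2133_G d (ℓ + 1) hd hL ha₀ ha₁
  refine ⟨δ / (((d : ℝ) + 1) * ((9 : ℕ) : ℝ)), by positivity,
    (((ℓ + 1) ^ (d + 1) : ℕ) : ℝ) * (A * Real.exp (δ * (((d : ℝ) + 1) + ((d : ℝ) + 1)) / (((d : ℝ) + 1) * ((9 : ℕ) : ℝ)))), by positivity, ?_⟩
  intro m K Mh k R P' hN D hk hMh1 hP4 a hMha hMh hR2 hℓ c hpl w cf
  have hP : ∀ μ, 1 ≤ P' μ := one_le_of_four_le hP4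
  have h1 := outDecay_window_V1 (t := tC hN hk hMh1 hP4 c ha₁ a (wC hN hk c w) cf) (x₀ := x0 ℓ Mh k c.1) (hx₀ := hx0 hpl)
    (hfit := hfit hN hMh1 hP4 hMha c ha₁ hpl) hN (D.chart (svec ℓ k c.1.1 c.1.2)) hA hδ.le (hmem _ 0 0) hMh1 hP
    (hdiv_cube hN hk hMh1 hP4 c ha₁ (wC hN hk c w) cf) (hlev_full hN hk hMh1 hP4 hMha c ha₁ hR2 (wC hN hk c w) cf) (C := 9) (by norm_num)
    (SQ hMh1 hP4 c) (fun b _ hbS => hband_cube hN hk hMh1 hP4 hMha c ha₁ hℓ hMh hR2 (wC hN hk c w) cf b hbS)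
  have h2 := outMajorant_smul_of_le_on (blkV1 hN (D.chart (svec ℓ k c.1.1 c.1.2))) h1 _
    (transplant_off hN hk hMh1 hP4 hMha c ha₁ hpl (wC hN hk c w) cf _) (inv_nonneg.2 (sc_nonneg hMh1 hP4 c cf))
    (K' := fun y y' => (((ℓ + 1) ^ (d + 1) : ℕ) : ℝ) * (A * Real.exp (δ * (((d : ℝ) + 1) + ((d : ℝ) + 1)) / (((d : ℝ) + 1) * ((9 : ℕ) : ℝ)))) *
      (sc hMh1 hP4 c cf)⁻¹ * Real.exp (-(δ / (((d : ℝ) + 1) * ((9 : ℕ) : ℝ)) * (geomT (D.chart (svec ℓ k c.1.1 c.1.2))).dist y y')))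
    (fun a b => by have := sc_nonneg hMh1 hP4 c cf; positivity)
    (fun b _ _ y => smul_kernel_le le_rfl (by positivity) (by positivity) (Real.exp_nonneg _))
  have h3 := outMajorant_conj_chart hN D hMh1 hP (svec ℓ k c.1.1 c.1.2) h2
    (K' := fun y y' => (((ℓ + 1) ^ (d + 1) : ℕ) : ℝ) * (A * Real.exp (δ * (((d : ℝ) + 1) + ((d : ℝ) + 1)) / (((d : ℝ) + 1) * ((9 : ℕ) : ℝ)))) *
      (sc hMh1 hP4 c cf)⁻¹ * Real.exp (-(δ / (((d : ℝ) + 1) * ((9 : ℕ) : ℝ)) * (geomT D).dist y y')))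
    (fun a b => le_of_eq (kernel_blkMap D hMh1 hP (svec ℓ k c.1.1 c.1.2) (fun _ => (sc hMh1 hP4 c cf)⁻¹) _ _ a b))
  rw [Gl_eq]
  exact outMajorant_congr_set _ (mem_blkMap_image_SQ hMh1 hP4 c) h3

end Cube

end Literature.MathematicalPhysics.QuantumFieldTheory.Balaban1983to89.B6CubeRightLegsV1

end
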